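import Literature.Geometry.Symplectic.SphereCRFamilyStability
import Literature.Geometry.Symplectic.SphereCRFamilySolutions
import Literature.Geometry.Symplectic.SphereCRCoreOfFamily
import Literature.Geometry.Symplectic.SphereCROperatorSmallPt
import Literature.Geometry.Symplectic.SphereCRLevelsFamily
import Literature.Geometry.Symplectic.SphereCRLinearisedRegularity
import Literature.Analysis.Complex.RiemannSphereSectionOperators
import HarnessLib

/-!
# Bootstrapping the implicit-function family to all Hölder levels: the deformation core

Layer B7 (assembly) of the analytic core of the Hofer–Lizan–Sikorav local foliation theorem
(Wendl 2018, Thm. 2.46; lead of crux `WitnessCharge`, summit `SmoothPoincare4`). The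
implicit-function family `γ : ball 0 ε → SecPair 1 r` of chart solutions
(`SphereCRFamily.exists_family`, base level `k = 1`) is shown to factor, locally near every
`a₁ ∈ ball 0 ε'`, through a `C^∞` family with values in EVERY level `SecPair m r`
(`exists_level_family`), whence the four chart representatives `(a, z) ↦ sec₀ ξₐ z, …` are
jointly `C^∞` on `ball 0 ε' × ℂ` (`contDiffOn_reps`) and the chart-level deformation core
`CoreFor 𝒥` follows (`SphereCRCoreOfFamily.coreFor_of_family`): **`coreFor : ∀ 𝒥, CoreFor 𝒥`**.

The level-`m` family near `a₁` is produced by the implicit function theorem AT LEVEL `m` at the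
lifted point `(a₁, y₁')` (`y₁' ∈ SecPair m r` over `γ a₁`, by the regularity of solutions
`SphereCRSolutionLevels` + the lift `SphereCRLevels.exists_inclLE_eq`), whose partial derivative
`D_y G_m (a₁, y₁')` is bijective: injective because it is the restriction of the level-`1`
operator `D_y G_1 (a₁, γ a₁)`, an isomorphism for `a₁` near `0` (`SphereCRFamilyStability`), the
levels being compatible (`SphereCRLevelsFamily`); surjective by the regularity of solutions of the
linearised equation (`SphereCRLinearisedRegularity`). Level-`1` uniqueness glues the level-`m`
family to `γ`.

## References

* C. Wendl, *Holomorphic Curves in Low Dimensions*, LNM 2216 (2018), §2.3, Thm. 2.46. [Wendl2018]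
-/

noncomputable section

open Set Filter Metric Function Complex
open scoped Topology NNReal ContDiff
open Literature.Analysis.FunctionSpaces Literature.Analysis.Complex.RiemannSphere
open Literature.Analysis.Complex.ProjectiveLineExpChart Literature.Geometry.Symplectic.CRExpression
open Literature.Analysis.Complex Literature.Analysis.Calculus

namespace Literature.Geometry.Symplectic

namespace SphereCR

namespace SphereACData

variable (𝒥 : SphereACData) {r : ℝ≥0}

/-! ### The implicit-function map at a general sup-norm small point -/

section General

variable (hr : r ≤ 1) (k : ℕ)

/-- The zero set of `G`: `G (a, y) = 0 ↔ FT y = 0 ∧ FN y = 0 ∧ slice₃ y.1 = 0 ∧ y.2 (0) = a`.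
[folklore] -/
theorem Gmap_eq_zero_iff (a : ℂ) (y : SecPair k r) :
    𝒥.Gmap hr k (a, y) = 0 ↔ 𝒥.FT hr k y = 0 ∧ 𝒥.FN hr k y = 0 ∧ slice₃ (k + 1) r y.1 = 0 ∧
      eval₀CLM (F := ℂ) (1 : ℂ → ℂ) (k + 1) r 0 y.2 = a := by
  simp only [Gmap, Prod.ext_iff, Prod.fst_zero, Prod.snd_zero, sub_eq_zero]
  tauto

/-- **The derivative of `G` at a general point** `(a, y)` with `y` sup-norm small.
[cite: Wendl2018, Thm. 2.46] -/
def GderivAt (y : SecPair k r) (hy : SmallPt y) : ℂ × SecPair k r →L[ℝ] Zsp k r :=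
  (((𝒥.LTAt hr k y hy).comp (ContinuousLinearMap.snd ℝ ℂ (SecPair k r))).prod
      ((𝒥.LNAt hr k y hy).comp (ContinuousLinearMap.snd ℝ ℂ (SecPair k r)))).prod
    ((((slice₃ (F := ℂ) (k + 1) r).comp (ContinuousLinearMap.fst ℝ _ _)).comp
        (ContinuousLinearMap.snd ℝ ℂ (SecPair k r))).prod
      (((eval₀CLM (F := ℂ) (1 : ℂ → ℂ) (k + 1) r 0).comp (ContinuousLinearMap.snd ℝ _ _)).comp
          (ContinuousLinearMap.snd ℝ ℂ (SecPair k r)) -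
        ContinuousLinearMap.fst ℝ ℂ (SecPair k r)))

/-- Values of `GderivAt`. [folklore] -/
@[simp] theorem GderivAt_apply (y : SecPair k r) (hy : SmallPt y) (p : ℂ × SecPair k r) :
    𝒥.GderivAt hr k y hy p = ((𝒥.LTAt hr k y hy p.2, 𝒥.LNAt hr k y hy p.2),
      (slice₃ (k + 1) r p.2.1, eval₀CLM (F := ℂ) (1 : ℂ → ℂ) (k + 1) r 0 p.2.2 - p.1)) := rfl

/-- **`G` has derivative `GderivAt y` at `(a, y)`** for `y` sup-norm small.
[cite: Wendl2018, Thm. 2.46] -/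
theorem hasFDerivAt_Gmap_of_smallPt (a : ℂ) {y : SecPair k r} (hy : SmallPt y) :
    HasFDerivAt (𝒥.Gmap hr k) (𝒥.GderivAt hr k y hy) (a, y) := by
  have hT : HasFDerivAt (fun p : ℂ × SecPair k r => 𝒥.FT hr k p.2)
      ((𝒥.LTAt hr k y hy).comp (ContinuousLinearMap.snd ℝ ℂ (SecPair k r))) (a, y) :=
    (show HasFDerivAt (𝒥.FT hr k) (𝒥.LTAt hr k y hy) (Prod.snd (a, y)) from
      𝒥.hasFDerivAt_FT_of_smallPt hr k hy).comp (a, y) hasFDerivAt_snd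
  have hN : HasFDerivAt (fun p : ℂ × SecPair k r => 𝒥.FN hr k p.2)
      ((𝒥.LNAt hr k y hy).comp (ContinuousLinearMap.snd ℝ ℂ (SecPair k r))) (a, y) :=
    (show HasFDerivAt (𝒥.FN hr k) (𝒥.LNAt hr k y hy) (Prod.snd (a, y)) from
      𝒥.hasFDerivAt_FN_of_smallPt hr k hy).comp (a, y) hasFDerivAt_snd
  have h3 : HasFDerivAt (fun p : ℂ × SecPair k r => slice₃ (k + 1) r p.2.1)
      (((slice₃ (F := ℂ) (k + 1) r).comp (ContinuousLinearMap.fst ℝ _ _)).comp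
        (ContinuousLinearMap.snd ℝ ℂ (SecPair k r))) (a, y) :=
    (((slice₃ (F := ℂ) (k + 1) r).comp (ContinuousLinearMap.fst ℝ _ _)).comp
      (ContinuousLinearMap.snd ℝ ℂ (SecPair k r))).hasFDerivAt
  have h4 : HasFDerivAt (fun p : ℂ × SecPair k r =>
      eval₀CLM (F := ℂ) (1 : ℂ → ℂ) (k + 1) r 0 p.2.2 - p.1)
      (((eval₀CLM (F := ℂ) (1 : ℂ → ℂ) (k + 1) r 0).comp (ContinuousLinearMap.snd ℝ _ _)).comp
          (ContinuousLinearMap.snd ℝ ℂ (SecPair k r)) -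
        ContinuousLinearMap.fst ℝ ℂ (SecPair k r)) (a, y) :=
    ((((eval₀CLM (F := ℂ) (1 : ℂ → ℂ) (k + 1) r 0).comp (ContinuousLinearMap.snd ℝ _ _)).comp
      (ContinuousLinearMap.snd ℝ ℂ (SecPair k r))).hasFDerivAt).sub
      (ContinuousLinearMap.fst ℝ ℂ (SecPair k r)).hasFDerivAt
  exact (hT.prodMk hN).prodMk (h3.prodMk h4)

/-- `G` is `C^∞` on `ℂ × {sup-norm small}`. [folklore] -/
theorem contDiffOn_Gmap_smallPt :
    ContDiffOn ℝ ∞ (𝒥.Gmap hr k) (univ ×ˢ {y : SecPair k r | SmallPt y}) := by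
  have hT : ContDiffOn ℝ ∞ (fun p : ℂ × SecPair k r => 𝒥.FT hr k p.2)
      (univ ×ˢ {y : SecPair k r | SmallPt y}) :=
    (𝒥.contDiffOn_FT_smallPt hr k).comp contDiff_snd.contDiffOn fun p hp => hp.2
  have hN : ContDiffOn ℝ ∞ (fun p : ℂ × SecPair k r => 𝒥.FN hr k p.2)
      (univ ×ˢ {y : SecPair k r | SmallPt y}) :=
    (𝒥.contDiffOn_FN_smallPt hr k).comp contDiff_snd.contDiffOn fun p hp => hp.2
  have h3 : ContDiff ℝ ∞ fun p : ℂ × SecPair k r => slice₃ (k + 1) r p.2.1 :=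
    (slice₃ (F := ℂ) (k + 1) r).contDiff.comp (contDiff_fst.comp contDiff_snd)
  have h4 : ContDiff ℝ ∞ fun p : ℂ × SecPair k r =>
      eval₀CLM (F := ℂ) (1 : ℂ → ℂ) (k + 1) r 0 p.2.2 - p.1 :=
    ((eval₀CLM (F := ℂ) (1 : ℂ → ℂ) (k + 1) r 0).contDiff.comp
      (contDiff_snd.comp contDiff_snd)).sub contDiff_fst
  exact (hT.prodMk hN).prodMk (h3.contDiffOn.prodMk h4.contDiffOn)

/-- The partial derivative of `G` in `y` at `(a, y)`. [folklore] -/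
theorem fderiv_Gmap_comp_inr_of_smallPt (a : ℂ) {y : SecPair k r} (hy : SmallPt y) :
    (fderiv ℝ (𝒥.Gmap hr k) (a, y)).comp (ContinuousLinearMap.inr ℝ ℂ (SecPair k r)) =
      (𝒥.GderivAt hr k y hy).comp (ContinuousLinearMap.inr ℝ ℂ (SecPair k r)) := by
  rw [(𝒥.hasFDerivAt_Gmap_of_smallPt hr k a hy).fderiv]

/-- Values of the partial derivative of `G` in `y`. [folklore] -/
theorem GderivAt_comp_inr_apply {y : SecPair k r} (hy : SmallPt y) (δ : SecPair k r) :
    (𝒥.GderivAt hr k y hy).comp (ContinuousLinearMap.inr ℝ ℂ (SecPair k r)) δ =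
      ((𝒥.LTAt hr k y hy δ, 𝒥.LNAt hr k y hy δ),
        (slice₃ (k + 1) r δ.1, eval₀CLM (F := ℂ) (1 : ℂ → ℂ) (k + 1) r 0 δ.2)) := by
  simp [GderivAt_apply]

end General

/-! ### Sup-norm smallness and the partial derivative across levels -/

section Levels

variable (hr : r ≤ 1) {k k' : ℕ} (h : k ≤ k')

/-- Sup-norm smallness is level independent. [folklore] -/
theorem smallPt_inclLE_iff (y : SecPair k' r) : SmallPt (SecPair.inclLE hr h y) ↔ SmallPt y :=
  Iff.rfl

/-- **The inclusion of the target spaces** `Zsp k' r →L Zsp k r` (inclusions on the two section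
factors, identity on the finite-dimensional border). [folklore] -/
def inclZ : Zsp k' r →L[ℝ] Zsp k r :=
  ((RiemannSphere.inclLE (F := ℂ) (τ := dbarClutch (fun w : ℂ => -w ^ 2)) hr h).prodMap
      (RiemannSphere.inclLE (F := ℂ) (τ := dbarClutch (1 : ℂ → ℂ)) hr h)).prodMap
    (ContinuousLinearMap.id ℝ ((ℂ × ℂ × ℂ) × ℂ))

/-- Values of `inclZ`. [folklore] -/
@[simp] theorem inclZ_apply (ζ : Zsp k' r) :
    inclZ hr h ζ = ((RiemannSphere.inclLE hr h ζ.1.1, RiemannSphere.inclLE hr h ζ.1.2), ζ.2) := rfl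

/-- `inclZ` is injective. [folklore] -/
theorem inclZ_injective : Injective (inclZ (r := r) hr h) := by
  rintro ⟨⟨a, b⟩, c⟩ ⟨⟨a', b'⟩, c'⟩ hh
  simp only [inclZ_apply, Prod.mk.injEq] at hh
  obtain ⟨⟨h1, h2⟩, h3⟩ := hh
  have ha : a = a' := RiemannSphere.inclLE_injective hr h h1
  have hb : b = b' := RiemannSphere.inclLE_injective hr h h2
  rw [ha, hb, h3]

/-- **The partial derivatives of `G` in `y` are compatible with the level inclusions**:
`inclZ (D_y G_{k'} (a, y) δ) = D_y G_k (a, inclLE y) (inclLE δ)`. [cite: Wendl2018, Thm. 2.46] -/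
theorem inclZ_GderivAt_inr (y : SecPair k' r) (hy : SmallPt y)
    (hy' : SmallPt (SecPair.inclLE hr h y)) (δ : SecPair k' r) :
    inclZ hr h ((𝒥.GderivAt hr k' y hy).comp (ContinuousLinearMap.inr ℝ ℂ (SecPair k' r)) δ) =
      (𝒥.GderivAt hr k (SecPair.inclLE hr h y) hy').comp
        (ContinuousLinearMap.inr ℝ ℂ (SecPair k r)) (SecPair.inclLE hr h δ) := by
  rw [𝒥.GderivAt_comp_inr_apply, 𝒥.GderivAt_comp_inr_apply, inclZ_apply, SecPair.inclLE_fst,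
    SecPair.inclLE_snd, RiemannSphere.slice₃_inclLE, RiemannSphere.eval₀CLM_inclLE]
  dsimp only
  refine Prod.ext (Prod.ext (Subtype.ext ?_) (Subtype.ext ?_)) rfl
  · rw [RiemannSphere.coe_inclLE, coe_LTAt, coe_LTAt, 𝒥.dPT_inclLE hr h]
  · rw [RiemannSphere.coe_inclLE, coe_LNAt, coe_LNAt, 𝒥.dPN_inclLE hr h]

end Levels

/-! ### Abstract back-and-forth between levels -/

/-- **Bijectivity one level up.** Let `ιY : Y₂ → Y₁`, `ιZ : Z₂ → Z₁` be injective,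
`L₂ : Y₂ → Z₂`, `L₁ : Y₁ → Z₁` with `ιZ ∘ L₂ = L₁ ∘ ιY`, `L₁` bijective, and REGULARITY:
`L₁ y ∈ range ιZ → y ∈ range ιY`. Then `L₂` is bijective. [folklore] -/
theorem bijective_of_level_compat {Y₁ Y₂ Z₁ Z₂ : Type*} (ιY : Y₂ → Y₁) (ιZ : Z₂ → Z₁)
    (L₂ : Y₂ → Z₂) (L₁ : Y₁ → Z₁) (hιY : Injective ιY) (hιZ : Injective ιZ)
    (hcomp : ∀ y, ιZ (L₂ y) = L₁ (ιY y)) (hL₁ : Bijective L₁)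
    (hreg : ∀ y : Y₁, L₁ y ∈ range ιZ → y ∈ range ιY) : Bijective L₂ := by
  constructor
  · intro a b hab
    apply hιY
    apply hL₁.1
    rw [← hcomp, ← hcomp, hab]
  · intro ζ
    obtain ⟨y, hy⟩ := hL₁.2 (ιZ ζ)
    obtain ⟨y', rfl⟩ := hreg y ⟨ζ, hy.symm⟩
    refine ⟨y', hιZ ?_⟩
    rw [hcomp, hy]

/-! ### The level-`m` family near a point of the level-`1` family -/

section LevelFamily

/-- **The implicit-function family factors locally through every level.** Let `γ : ℂ → SecPair 1 r`
be the level-`1` family on `ball 0 ε` (smooth, values in `ball 0 δ` where points are small, zeros of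
`G`, unique such zeros), with `D_y G (a, γ a)` an isomorphism and `γ a` an honest solution with
invertible transports on the discs of radius `3`, for all `‖a‖ < ε`. Then for every `m ≥ 1` and
`a₁ ∈ ball 0 ε` there is a `C^∞` map `γm : ball a₁ ε₁ → SecPair m r` with `inclLE (γm a) = γ a`.
[cite: Wendl2018, Thm. 2.46] -/
theorem exists_level_family (hr0 : 0 < r) (hr1 : r < 1) {ε δ : ℝ} (γ : ℂ → SecPair 1 r)
    (hγδ : ∀ a ∈ ball (0 : ℂ) ε, γ a ∈ ball (0 : SecPair 1 r) δ)
    (hsmall : ∀ y ∈ ball (0 : SecPair 1 r) δ, Small hr1.le 1 y)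
    (hzero : ∀ a ∈ ball (0 : ℂ) ε, 𝒥.Gmap hr1.le 1 (a, γ a) = 0)
    (huniq : ∀ a ∈ ball (0 : ℂ) ε, ∀ y ∈ ball (0 : SecPair 1 r) δ,
      𝒥.Gmap hr1.le 1 (a, y) = 0 → y = γ a)
    (he : ∀ a ∈ ball (0 : ℂ) ε, ∃ e : SecPair 1 r ≃L[ℝ] Zsp 1 r,
      (e : SecPair 1 r →L[ℝ] Zsp 1 r) =
        (fderiv ℝ (𝒥.Gmap hr1.le 1) (a, γ a)).comp (ContinuousLinearMap.inr ℝ ℂ (SecPair 1 r)))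
    (hU₀ : ∀ a ∈ ball (0 : ℂ) ε, ∀ z : ℂ, ‖z‖ < 3 →
      den z (sec₀ (fun w : ℂ => -w ^ 2) (γ a).1.1 z) ≠ 0 ∧
        IsUnit (𝒥.PhiJet₀ z (sec₀ (fun w : ℂ => -w ^ 2) (γ a).1.1 z) (sec₀ (1 : ℂ → ℂ) (γ a).2.1 z)))
    (hU₁ : ∀ a ∈ ball (0 : ℂ) ε, ∀ w : ℂ, ‖w‖ < 3 →
      den w (sec₁ (fun w : ℂ => -w ^ 2) (γ a).1.1 w) ≠ 0 ∧
        IsUnit (𝒥.PhiJet₁ w (sec₁ (fun w : ℂ => -w ^ 2) (γ a).1.1 w) (sec₁ (1 : ℂ → ℂ) (γ a).2.1 w)))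
    (hsol₀ : ∀ a ∈ ball (0 : ℂ) ε, ∀ z : ℂ, ‖z‖ < 3 →
      crExpr 𝒥.J₀ (𝒥.vmap₀ (sec₀ (fun w : ℂ => -w ^ 2) (γ a).1.1) (sec₀ (1 : ℂ → ℂ) (γ a).2.1)) z = 0)
    (hsol₁ : ∀ a ∈ ball (0 : ℂ) ε, ∀ w : ℂ, ‖w‖ < 3 →
      crExpr 𝒥.J₁ (𝒥.vmap₁ (sec₁ (fun w : ℂ => -w ^ 2) (γ a).1.1) (sec₁ (1 : ℂ → ℂ) (γ a).2.1)) w = 0)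
    {m : ℕ} (hm : 1 ≤ m) {a₁ : ℂ} (ha₁ : a₁ ∈ ball (0 : ℂ) ε) :
    ∃ ε₁ > (0 : ℝ), ∃ γm : ℂ → SecPair m r, ContDiffOn ℝ ∞ γm (ball a₁ ε₁) ∧
      ∀ a ∈ ball a₁ ε₁, SecPair.inclLE hr1.le hm (γm a) = γ a := by
  have hr : r ≤ 1 := hr1.le
  -- the base point `γ a₁` and its lift `y₁'` to level `m`
  have hy₁δ : γ a₁ ∈ ball (0 : SecPair 1 r) δ := hγδ a₁ ha₁
  have hy₁S : Small hr 1 (γ a₁) := hsmall _ hy₁δ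
  have hy₁P : SmallPt (γ a₁) := smallPt_of_small hy₁S
  obtain ⟨p1, p2, p3, p4⟩ := 𝒥.memContDiffHolder_pieces_of_sol hr0 hr1 (γ a₁)
    (fun z hz => (hU₀ a₁ ha₁ z hz).1) (fun w hw => (hU₁ a₁ ha₁ w hw).1) (hsol₀ a₁ ha₁)
    (hsol₁ a₁ ha₁) (m + 1)
  obtain ⟨y₁', hy₁'⟩ := SecPair.exists_inclLE_eq hr hm (γ a₁) p1 p2 p3 p4
  have hsP : SmallPt (SecPair.inclLE hr hm y₁') := by rw [hy₁']; exact hy₁P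
  have hy₁'P : SmallPt y₁' := (smallPt_inclLE_iff hr hm y₁').1 hsP
  -- the two partial derivatives
  obtain ⟨e, he₁⟩ := he a₁ ha₁
  set L₂ : SecPair m r →L[ℝ] Zsp m r :=
    (𝒥.GderivAt hr m y₁' hy₁'P).comp (ContinuousLinearMap.inr ℝ ℂ (SecPair m r)) with hL₂
  have hL₁ : ∀ w : SecPair 1 r, e w =
      (𝒥.GderivAt hr 1 (γ a₁) hy₁P).comp (ContinuousLinearMap.inr ℝ ℂ (SecPair 1 r)) w := by
    intro w
    have h1 := congrArg (fun T : SecPair 1 r →L[ℝ] Zsp 1 r => T w) he₁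
    simp only [ContinuousLinearEquiv.coe_coe] at h1
    rw [h1, 𝒥.fderiv_Gmap_comp_inr_of_smallPt hr 1 a₁ hy₁P]
  -- `D_y G_m (a₁, y₁')` is bijective
  have hbij : Bijective L₂ := by
    refine bijective_of_level_compat (SecPair.inclLE hr hm) (inclZ hr hm) L₂ e
      (SecPair.inclLE_injective hr hm) (inclZ_injective hr hm) (fun δ' => ?_) e.bijective
      (fun w hw => ?_)
    · -- compatibility with the level inclusions
      rw [hL₁, hL₂, 𝒥.inclZ_GderivAt_inr hr hm y₁' hy₁'P hsP δ', 𝒥.GderivAt_comp_inr_apply,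
        𝒥.GderivAt_comp_inr_apply]
      refine Prod.ext (Prod.ext (Subtype.ext ?_) (Subtype.ext ?_)) rfl
      · rw [coe_LTAt, coe_LTAt, hy₁']
      · rw [coe_LNAt, coe_LNAt, hy₁']
    · -- regularity of solutions of the linearised equation
      obtain ⟨ζ, hζ⟩ := hw
      rw [hL₁, 𝒥.GderivAt_comp_inr_apply, inclZ_apply, Prod.ext_iff, Prod.ext_iff] at hζ
      obtain ⟨⟨hζ1, hζ2⟩, -⟩ := hζ
      have hT := congrArg Subtype.val hζ1
      have hN := congrArg Subtype.val hζ2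
      rw [RiemannSphere.coe_inclLE, coe_LTAt] at hT
      rw [RiemannSphere.coe_inclLE, coe_LNAt] at hN
      have m1 : MemContDiffHolder m r ((𝒥.dPT hr 1 (γ a₁) w).1 : ℂ → ℂ) := by
        rw [← hT, Prod.map_fst, ContDiffHolderFunction.coe_inclLE]
        exact (ζ.1.1 : ContDiffHolderFunction ℂ ℂ m r × ContDiffHolderFunction ℂ ℂ m r).1.memContDiffHolder
      have m2 : MemContDiffHolder m r ((𝒥.dPT hr 1 (γ a₁) w).2 : ℂ → ℂ) := by
        rw [← hT, Prod.map_snd, ContDiffHolderFunction.coe_inclLE]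
        exact (ζ.1.1 : ContDiffHolderFunction ℂ ℂ m r × ContDiffHolderFunction ℂ ℂ m r).2.memContDiffHolder
      have m3 : MemContDiffHolder m r ((𝒥.dPN hr 1 (γ a₁) w).1 : ℂ → ℂ) := by
        rw [← hN, Prod.map_fst, ContDiffHolderFunction.coe_inclLE]
        exact (ζ.1.2 : ContDiffHolderFunction ℂ ℂ m r × ContDiffHolderFunction ℂ ℂ m r).1.memContDiffHolder
      have m4 : MemContDiffHolder m r ((𝒥.dPN hr 1 (γ a₁) w).2 : ℂ → ℂ) := by
        rw [← hN, Prod.map_snd, ContDiffHolderFunction.coe_inclLE]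
        exact (ζ.1.2 : ContDiffHolderFunction ℂ ℂ m r × ContDiffHolderFunction ℂ ℂ m r).2.memContDiffHolder
      obtain ⟨q1, q2, q3, q4⟩ := 𝒥.memContDiffHolder_succ_pieces_of_linearised hr0 hr1 le_rfl hy₁S
        (hU₀ a₁ ha₁) (hU₁ a₁ ha₁) (hsol₀ a₁ ha₁) (hsol₁ a₁ ha₁) w m1 m2 m3 m4
      exact (SecPair.mem_range_inclLE_iff hr hm w).2 ⟨q1, q2, q3, q4⟩
  -- the implicit function theorem at level `m`
  set Lm : SecPair m r ≃L[ℝ] Zsp m r := ContinuousLinearEquiv.ofBijective L₂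
    (LinearMap.ker_eq_bot.2 hbij.1) (LinearMap.range_eq_top.2 hbij.2) with hLm
  have hUm : (univ ×ˢ {y : SecPair m r | SmallPt y}) ∈ 𝓝 (a₁, y₁') :=
    prod_mem_nhds univ_mem (isOpen_smallPt.mem_nhds hy₁'P)
  have h0m : 𝒥.Gmap hr m (a₁, y₁') = 0 := by
    have h0 := hzero a₁ ha₁
    rw [← hy₁'] at h0
    exact (𝒥.Gmap_inclLE_eq_zero_iff hr hm a₁ y₁').1 h0
  have hLm' : (fderiv ℝ (𝒥.Gmap hr m) (a₁, y₁')).comp (ContinuousLinearMap.inr ℝ ℂ (SecPair m r)) =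
      (Lm : SecPair m r →L[ℝ] Zsp m r) := by
    rw [𝒥.fderiv_Gmap_comp_inr_of_smallPt hr m a₁ hy₁'P, hLm, ContinuousLinearEquiv.coe_ofBijective]
  obtain ⟨εm, hεm, δm, -, γm, hγms, hγm0, -, hγmz, -, -, -⟩ :=
    exists_smooth_implicitFunction_of_contDiffOn' (𝒥.Gmap hr m) a₁ y₁' _ hUm
      (𝒥.contDiffOn_Gmap_smallPt hr m) h0m Lm hLm'
  -- gluing to `γ` by level-`1` uniqueness
  have hcont : ContinuousAt (fun a => SecPair.inclLE hr hm (γm a)) a₁ :=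
    (SecPair.inclLE hr hm).continuous.continuousAt.comp
      (hγms.continuousOn.continuousAt (ball_mem_nhds a₁ hεm))
  have hev1 : ∀ᶠ a in 𝓝 a₁, SecPair.inclLE hr hm (γm a) ∈ ball (0 : SecPair 1 r) δ := by
    refine hcont.preimage_mem_nhds (isOpen_ball.mem_nhds ?_)
    show SecPair.inclLE hr hm (γm a₁) ∈ ball (0 : SecPair 1 r) δ
    rw [hγm0, hy₁']
    exact hy₁δ
  have hev2 : ∀ᶠ a in 𝓝 a₁, a ∈ ball (0 : ℂ) ε := isOpen_ball.mem_nhds ha₁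
  have hev3 : ∀ᶠ a in 𝓝 a₁, a ∈ ball a₁ εm := ball_mem_nhds a₁ hεm
  obtain ⟨ε₁, hε₁, hball⟩ := Metric.eventually_nhds_iff_ball.1 ((hev1.and hev2).and hev3)
  refine ⟨min ε₁ εm, lt_min hε₁ hεm, γm, hγms.mono (ball_subset_ball (min_le_right _ _)),
    fun a ha => ?_⟩
  obtain ⟨⟨h1, h2⟩, h3⟩ := hball a (ball_subset_ball (min_le_left _ _) ha)
  exact huniq a h2 _ h1 ((𝒥.Gmap_inclLE_eq_zero_iff hr hm a (γm a)).2 (hγmz a h3))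

end LevelFamily

/-! ### Joint smoothness of the representatives -/

section Joint

/-- **A level-`1` family which factors locally through every level has jointly `C^∞`
representatives**, for any representative functional `R j : SecPair j r → ℂ → ℂ` which is level
independent and jointly `C^{j+1}` at level `j` (e.g. `(y, z) ↦ sec₀ ξ z`). [folklore] -/
theorem contDiffOn_rep_of_level_families (hr : r ≤ 1) {ε : ℝ} (γ : ℂ → SecPair 1 r)
    (hloc : ∀ (m : ℕ) (hm : 1 ≤ m), ∀ a₁ ∈ ball (0 : ℂ) ε, ∃ ε₁ > (0 : ℝ), ∃ γm : ℂ → SecPair m r,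
      ContDiffOn ℝ ∞ γm (ball a₁ ε₁) ∧ ∀ a ∈ ball a₁ ε₁, SecPair.inclLE hr hm (γm a) = γ a)
    (R : ∀ j : ℕ, SecPair j r → ℂ → ℂ)
    (hR : ∀ (j : ℕ) (hj : 1 ≤ j) (y : SecPair j r), R 1 (SecPair.inclLE hr hj y) = R j y)
    (hRs : ∀ j : ℕ, ContDiff ℝ (j + 1 : ℕ) (fun q : SecPair j r × ℂ => R j q.1 q.2)) :
    ContDiffOn ℝ ∞ (fun q : ℂ × ℂ => R 1 (γ q.1) q.2) (ball 0 ε ×ˢ univ) := by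
  refine contDiffOn_infty.2 fun n => ?_
  set m : ℕ := max n 1 with hm_def
  have hm : 1 ≤ m := le_max_right _ _
  have hnm : (n : WithTop ℕ∞) ≤ ((m + 1 : ℕ) : WithTop ℕ∞) := by
    exact_mod_cast (le_max_left n 1).trans (Nat.le_succ m)
  refine contDiffOn_of_locally_contDiffOn fun q hq => ?_
  obtain ⟨ha₁, -⟩ := hq
  obtain ⟨ε₁, hε₁, γm, hγms, hγeq⟩ := hloc m hm q.1 ha₁
  refine ⟨ball q.1 ε₁ ×ˢ univ, isOpen_ball.prod isOpen_univ, ⟨mem_ball_self hε₁, mem_univ _⟩, ?_⟩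
  -- on the neighbourhood the representative is that of the level-`m` family
  have hin : ContDiffOn ℝ ∞ (fun q' : ℂ × ℂ => ((γm q'.1, q'.2) : SecPair m r × ℂ))
      (ball q.1 ε₁ ×ˢ univ) :=
    (hγms.comp contDiffOn_fst fun q' hq' => hq'.1).prodMk contDiffOn_snd
  have hg : ContDiffOn ℝ n (fun q' : ℂ × ℂ => R m (γm q'.1) q'.2) (ball q.1 ε₁ ×ˢ univ) :=
    ((hRs m).of_le hnm).comp_contDiffOn (hin.of_le (by exact_mod_cast le_top))
  refine (hg.mono inter_subset_right).congr fun q' hq' => ?_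
  show R 1 (γ q'.1) q'.2 = R m (γm q'.1) q'.2
  rw [← hγeq q'.1 hq'.2.1, hR m hm]

/-- **Joint smoothness of the four representatives** of a level-`1` family factoring locally
through every level. [cite: Wendl2018, Thm. 2.46] -/
theorem contDiffOn_reps_of_level_families (hr : r ≤ 1) {ε : ℝ} (γ : ℂ → SecPair 1 r)
    (hloc : ∀ (m : ℕ) (hm : 1 ≤ m), ∀ a₁ ∈ ball (0 : ℂ) ε, ∃ ε₁ > (0 : ℝ), ∃ γm : ℂ → SecPair m r,
      ContDiffOn ℝ ∞ γm (ball a₁ ε₁) ∧ ∀ a ∈ ball a₁ ε₁, SecPair.inclLE hr hm (γm a) = γ a) :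
    ContDiffOn ℝ ∞ (fun q : ℂ × ℂ => sec₀ (fun w : ℂ => -w ^ 2) (γ q.1).1.1 q.2) (ball 0 ε ×ˢ univ) ∧
    ContDiffOn ℝ ∞ (fun q : ℂ × ℂ => sec₁ (fun w : ℂ => -w ^ 2) (γ q.1).1.1 q.2) (ball 0 ε ×ˢ univ) ∧
    ContDiffOn ℝ ∞ (fun q : ℂ × ℂ => sec₀ (1 : ℂ → ℂ) (γ q.1).2.1 q.2) (ball 0 ε ×ˢ univ) ∧
    ContDiffOn ℝ ∞ (fun q : ℂ × ℂ => sec₁ (1 : ℂ → ℂ) (γ q.1).2.1 q.2) (ball 0 ε ×ˢ univ) := by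
  have lin₁ : ∀ j : ℕ, ContDiff ℝ ∞ (fun q : SecPair j r × ℂ =>
      ((q.1.1, q.2) : holderSections ℂ (fun w : ℂ => -w ^ 2) (j + 1) r × ℂ)) := fun j =>
    (contDiff_fst.comp contDiff_fst).prodMk contDiff_snd
  have lin₂ : ∀ j : ℕ, ContDiff ℝ ∞ (fun q : SecPair j r × ℂ =>
      ((q.1.2, q.2) : holderSections ℂ (1 : ℂ → ℂ) (j + 1) r × ℂ)) := fun j =>
    (contDiff_snd.comp contDiff_fst).prodMk contDiff_snd
  refine ⟨contDiffOn_rep_of_level_families hr γ hloc (fun j y z => sec₀ (fun w : ℂ => -w ^ 2) y.1.1 z)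
      (fun j hj y => rfl) (fun j => ?_),
    contDiffOn_rep_of_level_families hr γ hloc (fun j y w => sec₁ (fun w : ℂ => -w ^ 2) y.1.1 w)
      (fun j hj y => rfl) (fun j => ?_),
    contDiffOn_rep_of_level_families hr γ hloc (fun j y z => sec₀ (1 : ℂ → ℂ) y.2.1 z)
      (fun j hj y => rfl) (fun j => ?_),
    contDiffOn_rep_of_level_families hr γ hloc (fun j y w => sec₁ (1 : ℂ → ℂ) y.2.1 w)
      (fun j hj y => rfl) (fun j => ?_)⟩
  · exact (contDiff_eval_sec₀ (F := ℂ) (τ := fun w : ℂ => -w ^ 2) (k := j + 1) (r := r)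
      neg_sq_clutch_ne_zero contDiffOn_neg_sq_clutch hr).comp ((lin₁ j).of_le (by exact_mod_cast le_top))
  · exact (contDiff_eval_sec₁ (F := ℂ) (τ := fun w : ℂ => -w ^ 2) (k := j + 1) (r := r)
      contDiffOn_neg_sq_clutch hr).comp ((lin₁ j).of_le (by exact_mod_cast le_top))
  · exact (contDiff_eval_sec₀ (F := ℂ) (τ := (1 : ℂ → ℂ)) (k := j + 1) (r := r)
      one_clutch_ne_zero contDiffOn_one_clutch hr).comp ((lin₂ j).of_le (by exact_mod_cast le_top))
  · exact (contDiff_eval_sec₁ (F := ℂ) (τ := (1 : ℂ → ℂ)) (k := j + 1) (r := r)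
      contDiffOn_one_clutch hr).comp ((lin₂ j).of_le (by exact_mod_cast le_top))

end Joint

/-! ### The deformation core -/

/-- **The chart-level deformation core holds for every `𝒥`** (Hölder exponent `1/2`, base level
`1`): the implicit-function family bootstrapped to all levels. [cite: Wendl2018, Thm. 2.46] -/
theorem coreFor : 𝒥.CoreFor := by
  have hr0 : (0 : ℝ≥0) < 2⁻¹ := by norm_num
  have hr1 : (2⁻¹ : ℝ≥0) < 1 := by norm_num
  have hr : (2⁻¹ : ℝ≥0) ≤ 1 := hr1.le
  obtain ⟨ε, hε, δ, -, γ, hγs, hγ0, hγδ, hsmall, hzero, huniq, -⟩ :=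
    𝒥.exists_family (r := 2⁻¹) (k := 1) hr0 hr1 le_rfl
  have hγc0 : ContinuousAt γ 0 := hγs.continuousOn.continuousAt (ball_mem_nhds 0 hε)
  have hsm : ∀ a ∈ ball (0 : ℂ) ε, Small hr1.le 1 (γ a) := fun a ha => hsmall _ (hγδ a ha)
  obtain ⟨ε₂, hε₂, hε₂ε, he⟩ := 𝒥.exists_pos_forall_isEquiv_fderiv hr0 hr1 le_rfl hε γ
    hγs.continuousOn hγ0 hsm
  obtain ⟨ε₃, hε₃, -, δu, -, hU₀, hU₁, hfacts⟩ := 𝒥.exists_pos_forall_sol hr1 hε γ hγ0 hγc0 hsm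
    (fun a ha => ⟨(hzero a ha).1, (hzero a ha).2.1⟩)
  set ε' : ℝ := min ε₂ ε₃ with hε'_def
  have hε' : 0 < ε' := lt_min hε₂ hε₃
  have hε'ε : ε' ≤ ε := (min_le_left _ _).trans hε₂ε
  have hb : ∀ {a : ℂ}, a ∈ ball (0 : ℂ) ε' → a ∈ ball (0 : ℂ) ε := fun ha => ball_subset_ball hε'ε ha
  have hb₂ : ∀ {a : ℂ}, a ∈ ball (0 : ℂ) ε' → a ∈ ball (0 : ℂ) ε₂ := fun ha =>
    ball_subset_ball (min_le_left _ _) ha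
  have hb₃ : ∀ {a : ℂ}, a ∈ ball (0 : ℂ) ε' → a ∈ ball (0 : ℂ) ε₃ := fun ha =>
    ball_subset_ball (min_le_right _ _) ha
  -- the family facts on `ball 0 ε'`
  have hzero' : ∀ a ∈ ball (0 : ℂ) ε', 𝒥.Gmap hr 1 (a, γ a) = 0 := fun a ha =>
    (𝒥.Gmap_eq_zero_iff hr 1 a (γ a)).2 (hzero a (hb ha))
  have huniq' : ∀ a ∈ ball (0 : ℂ) ε', ∀ y ∈ ball (0 : SecPair 1 (2⁻¹ : ℝ≥0)) δ,
      𝒥.Gmap hr 1 (a, y) = 0 → y = γ a := fun a ha y hy h0 => by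
    obtain ⟨h1, h2, h3, h4⟩ := (𝒥.Gmap_eq_zero_iff hr 1 a y).1 h0
    exact huniq a (hb ha) y hy h1 h2 h3 h4
  have hU₀' : ∀ a ∈ ball (0 : ℂ) ε', ∀ z : ℂ, ‖z‖ < 3 →
      den z (sec₀ (fun w : ℂ => -w ^ 2) (γ a).1.1 z) ≠ 0 ∧
        IsUnit (𝒥.PhiJet₀ z (sec₀ (fun w : ℂ => -w ^ 2) (γ a).1.1 z) (sec₀ (1 : ℂ → ℂ) (γ a).2.1 z)) :=
    fun a ha z hz => by
      obtain ⟨hbd, -, -⟩ := hfacts a (hb₃ ha)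
      obtain ⟨b1, b2, -, -⟩ := hbd z (hz.le.trans (by norm_num))
      exact hU₀ z _ _ hz.le b1 b2
  have hU₁' : ∀ a ∈ ball (0 : ℂ) ε', ∀ w : ℂ, ‖w‖ < 3 →
      den w (sec₁ (fun w : ℂ => -w ^ 2) (γ a).1.1 w) ≠ 0 ∧
        IsUnit (𝒥.PhiJet₁ w (sec₁ (fun w : ℂ => -w ^ 2) (γ a).1.1 w) (sec₁ (1 : ℂ → ℂ) (γ a).2.1 w)) :=
    fun a ha w hw => by
      obtain ⟨hbd, -, -⟩ := hfacts a (hb₃ ha)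
      obtain ⟨-, -, b3, b4⟩ := hbd w (hw.le.trans (by norm_num))
      exact hU₁ w _ _ hw.le b3 b4
  have hsol₀' : ∀ a ∈ ball (0 : ℂ) ε', ∀ z : ℂ, ‖z‖ < 3 →
      crExpr 𝒥.J₀ (𝒥.vmap₀ (sec₀ (fun w : ℂ => -w ^ 2) (γ a).1.1) (sec₀ (1 : ℂ → ℂ) (γ a).2.1)) z = 0 :=
    fun a ha z hz => ((hfacts a (hb₃ ha)).2.1 z hz).2
  have hsol₁' : ∀ a ∈ ball (0 : ℂ) ε', ∀ w : ℂ, ‖w‖ < 3 →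
      crExpr 𝒥.J₁ (𝒥.vmap₁ (sec₁ (fun w : ℂ => -w ^ 2) (γ a).1.1) (sec₁ (1 : ℂ → ℂ) (γ a).2.1)) w = 0 :=
    fun a ha w hw => ((hfacts a (hb₃ ha)).2.2 w hw).2
  -- bootstrapping: local level-`m` families, hence joint smoothness
  have hloc : ∀ (m : ℕ) (hm : 1 ≤ m), ∀ a₁ ∈ ball (0 : ℂ) ε', ∃ ε₁ > (0 : ℝ),
      ∃ γm : ℂ → SecPair m (2⁻¹ : ℝ≥0), ContDiffOn ℝ ∞ γm (ball a₁ ε₁) ∧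
        ∀ a ∈ ball a₁ ε₁, SecPair.inclLE hr hm (γm a) = γ a :=
    fun m hm a₁ ha₁ => 𝒥.exists_level_family hr0 hr1 γ (fun a ha => hγδ a (hb ha)) hsmall hzero'
      huniq' (fun a ha => he a (hb₂ ha)) hU₀' hU₁' hsol₀' hsol₁' hm ha₁
  obtain ⟨j1, j2, j3, j4⟩ := contDiffOn_reps_of_level_families hr γ hloc
  exact 𝒥.coreFor_of_family hr1 hε' γ hγ0 hγc0 (fun a ha => hsm a (hb ha))
    (fun a ha => ⟨(hzero a (hb ha)).1, (hzero a (hb ha)).2.1, (hzero a (hb ha)).2.2.2⟩) j1 j2 j3 j4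

/-- **Discharge of the named statement `CoreFor`**: it holds for every `𝒥`. [cite: Wendl2018, Thm. 2.46] -/
theorem CoreFor_holds : ∀ 𝒥 : SphereACData, 𝒥.CoreFor := fun 𝒥 => 𝒥.coreFor

end SphereACData

end SphereCR

end Literature.Geometry.Symplectic

end
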